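import Summits.AtomisticToContinuum.Crystallization.Theses.PalmUnimodularRigidity
import Literature.Probability.Process.PointStationaryLaw
import Literature.MathematicalPhysics.StatisticalMechanics.RootEnergy
import Literature.Geometry.DiscreteGeometry.DelaunayTriangulation
import Literature.Geometry.DiscreteGeometry.KissingPatterns

/-!
# Line `two-cell-alphabet-star` — checked skeleton for crux `MinimiserShells` (stmt-AtomisticToContinuum-9225)

Route `route-AtomisticToContinuum-PalmUnimodularRigidity`; crux decl
`Summit.AtomisticToContinuum.Crystallization.Theses.PalmUnimodularRigidity.MinimiserShells`, concluded BY
NAME by `MinimiserShells_of` below (its only hypothesis is the route's own registered support item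
`UnimodularEnergyLowerBound`, stmt-AtomisticToContinuum-9229 — the hidden prerequisite certified by the
disprover, `Disproof.lean` §3 / `Theorems/MinimiserShells/Negative/HiddenDependency.lean`).  Planner seat
`planner-cruxplan-stmt-AtomisticToContinuum-9225-two-cell-alphabet-st-0`, 2026-08-16; line card
`Cruxes/MinimiserShells/Lines/two-cell-alphabet-star.md`; idea card `Ideas/two-cell-alphabet-star.md`.

## The line in one paragraph

Replace the barred single-SHELL inference (twelve soft neighbours ⇒ pattern: false at `1 %`,
`DecahedralSoftShell`, negative 4146) by a single-SITE CELL inference.  The Delaunay cells of the LOCAL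
site set `ω = S ∩ B̄(0, 2a)` that have the root as a vertex (empty circumsphere among the sites,
`Literature.Geometry.DiscreteGeometry.HasEmptyCircumsphere`) are required to be letters of the close-packing
alphabet at the site's own scale `a` and tolerance `η = 1/2000`: **T** (regular `a`-tetrahedron), **Q**
(quarter of the regular `a`-octahedron: five edges `a`, one `√2·a`) or **Z** (a flat square of the
octahedron seen as a degenerate/sliver cell: four edges `a`, the two OPPOSITE ones `√2·a`).  Dihedral
closure around every root edge then admits only "two T plus octahedral material" at a unit edge (the
five-T ring misses `2π` by `2π − 5·arccos(1/3) ≈ 7.36°`, tree `five_mul_lt_two_pi`,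
`frustrationGap_bounds`), Euler on the link forces `8 T + 6` octahedra, the link is the cuboctahedron or
the anticuboctahedron WITH its square data (a pinned diagonal or a cap per square), and that framework is
first-order rigid, so the twelve shell points are `(a/100)`-close to the `a`-scaled FCC or HCP kissing
pattern.  The energy side owes one almost-sure CELL statement for minimising point-stationary laws
(`stub_selection`, the crux-hard core, stated conditionally on item 9229).

## Shape

* Definitions block (namespace `Summit.AtomisticToContinuum.Crystallization.Theorems.MinimiserShellsAlphabet`):
  every object and the three stub statements as named `Prop`s.  LEAD: land this block verbatim as
  `Summits/AtomisticToContinuum/Crystallization/Theorems/PalmUnimodularRigidityMinimiserShellsAlphabetDefs.lean`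
  (sorry-free, `--supports stmt-AtomisticToContinuum-9225`) first, then replace the block here by the
  import; the registered stub signatures stay byte-identical.
* Three registered stubs (the only `sorry`s): `stub_starChart : StarRecognition (1/2000)` (geometry I:
  Delaunay star + ring closure + Euler + classification ⇒ a labelled chart onto the FCC/HCP pattern with
  square data), `stub_chartRigidity : ChartRigidity (1/2000) (1/100)` (geometry II: quantitative rigidity
  of the charted framework, amplification budget ×20), `stub_selection : UnimodularEnergyLowerBound →
  AlphabetSelection (1/2000)` (energy core, hardest).
* Proved glue: `minimiserShells_iff` (`Iff.rfl` fold of the crux), `alphabetStarRigidity_of`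
  (I + II ⇒ `AlphabetStarRigidity`), `goodShell_ae_of_alphabet` (rigidity + selection ⇒ the crux's
  conclusion a.s.), and the composition `MinimiserShells_of`.

## Constants

`η = 1/2000` on both sides, display tolerance `a/100` (the crux's), i.e. an amplification budget of `20`
for the rigidity step.  Calibration (planner kit job j010844, 2026-08-16): (A) the bare 36-bar twelve-shell
(12 radial + 24 contacts) has rigidity rank `35/36` in both patterns — the jitterbug flex — and becomes
infinitesimally rigid with the square data for ALL `3⁶` diagonal/diagonal/cap assignments, worst linear
sup-norm amplification `4.74` (fcc) / `5.21` (hcp), `≤ 5.36` / `≤ 5.89` after direction covering, so the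
budget is `≈ 3.4×` the optimal linear constant (the card's `(1/400, C = 4)` is retired: `4 < 4.74`);
(B) dihedral sensitivities `K_T = 3.77`, `K_Q ∈ {4.30 (54.7°), 6.71 (109.5°), 7.41 (90°)}`,
`K_O = 6.13` rad per unit relative edge strain; (C) the ring table at a unit root edge: solutions
`(n_T, n_α, n_2α) ∈ {(2,0,2), (2,2,1), (2,4,0)}`, nearest non-solution the five-T ring at `−7.36°` with
`ΣK = 18.9` rad (so it closes only from `η ≈ 0.0068`, matching `DecahedralSoftShell`'s `η⋆ = 0.0067`),
then `±15.8°`; at `η = 1/2000` every ring's total linear deviation is `≤ 0.71°`.  On the energy side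
relaxed LJ hcp (`c/a = 1.63277`, `2.3e-4` below ideal: two independent kit jobs of the ideators) has
letter distortion `≈ 4.7e-5·a` after the free per-site scale (`≈ 1e-4·a` for relaxed polytypes), so
`η = 5e-4` keeps a factor `5–10` and `η → 0` would be FALSE.
-/

noncomputable section

open scoped BigOperators ENNReal Classical
open MeasureTheory Set Filter Metric
open Literature.MathematicalPhysics.StatisticalMechanics
open Literature.Geometry.DiscreteGeometry
open Literature.Probability.Process

/-! ## Definitions block — objects of the line and the three stub statements

(To be landed verbatim as `Theorems/PalmUnimodularRigidityMinimiserShellsAlphabetDefs.lean`; nothing in this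
block uses `sorry`.) -/

namespace Summit.AtomisticToContinuum.Crystallization.Theorems.MinimiserShellsAlphabet

/-- Euclidean `3`-space. -/
local notation "E3" => EuclideanSpace ℝ (Fin 3)

/-! ### A. The crux's own terms -/

/-- `e* = ⨅` over periodic configurations of the Lennard-Jones energy per particle (the crux's inlined
term). -/
def eStar : ℝ := ⨅ Q : PeriodicConfiguration 3, Q.energyPerParticle lennardJones

/-- The points of `S` other than the root within `5a/4` of it — the crux's "root shell" at scale `a`. -/
def rootShell (a : ℝ) (S : Set E3) : Set E3 := {y : E3 | y ∈ S ∧ y ≠ 0 ∧ ‖y‖ ≤ 5 / 4 * a}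

/-- The crux's conclusion for ONE rooted configuration `μ` (tolerance `a/100`), verbatim. -/
def GoodShell (μ : Measure E3) : Prop :=
  ∃ a : ℝ, 9 / 10 ≤ a ∧ a ≤ 1 ∧ ∃ T : Finset E3,
    (↑T : Set E3) = {y : E3 | μ {y} ≠ 0 ∧ y ≠ 0 ∧ ‖y‖ ≤ 5 / 4 * a} ∧
    (ShellCloseTo (a / 100) T (Finset.image (fun v : E3 => a • v) fccKissingPattern) ∨
      ShellCloseTo (a / 100) T (Finset.image (fun v : E3 => a • v) hcpKissingPattern))

/-! ### B. The alphabet: letters T, Q, Z for a tetrahedron `(0, p, q, r)` at the root -/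

/-- The six edge lengths of the tetrahedron `(0, p, q, r)`, ordered so that the edges with indices `i`
and `i + 3` are OPPOSITE: `0p | 0q | 0r | qr | rp | pq`. -/
def rootTetEdges (p q r : E3) : Fin 6 → ℝ := ![‖p‖, ‖q‖, ‖r‖, dist q r, dist r p, dist p q]

/-- Letter **T** at scale `a`, tolerance `η`: all six edges within `η·a` of `a` (regular `a`-tetrahedron). -/
def IsLetterT (η a : ℝ) (e : Fin 6 → ℝ) : Prop := ∀ i, |e i - a| ≤ η * a

/-- Letter **Q**: one edge within `η·a` of `√2·a`, the other five within `η·a` of `a` (a quarter of the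
regular `a`-octahedron — the Delaunay pieces of an octahedral hole cut along one of its diagonals). -/
def IsLetterQ (η a : ℝ) (e : Fin 6 → ℝ) : Prop :=
  ∃ j : Fin 6, |e j - Real.sqrt 2 * a| ≤ η * a ∧ ∀ i, i ≠ j → |e i - a| ≤ η * a

/-- Letter **Z**: two OPPOSITE edges within `η·a` of `√2·a`, the other four within `η·a` of `a` (a flat
square of the regular `a`-octahedron — the sliver cell a saddle-perturbed octahedral hole presents; it
answers the triage's sliver-fragility attack, TRIAGE-r1-3). -/
def IsLetterZ (η a : ℝ) (e : Fin 6 → ℝ) : Prop :=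
  ∃ j : Fin 6, |e j - Real.sqrt 2 * a| ≤ η * a ∧ |e (j + 3) - Real.sqrt 2 * a| ≤ η * a ∧
    ∀ i, i ≠ j → i ≠ j + 3 → |e i - a| ≤ η * a

/-- A **letter** of the close-packing alphabet `{T, Q, Z}` at scale `a`, tolerance `η`.  Every
non-coplanar 4-subset of a near-regular octahedron containing a given vertex is a Q or a Z, so the
predicate is robust under perturbation of the sites (unlike `{T, Q}` alone). -/
def IsLetter (η a : ℝ) (e : Fin 6 → ℝ) : Prop := IsLetterT η a e ∨ IsLetterQ η a e ∨ IsLetterZ η a e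

/-! ### C. Root cells of the LOCAL site set and the alphabet star -/

/-- The local site set at scale `a`: the points of `S` within `2a` of the root.  Emptiness of
circumspheres is tested against these sites only (letters have circumradius `≤ 0.71·a(1 + O(η))` and
circumcentre within that distance of the root, so for hard-core `S` local and global emptiness agree;
testing against all of `S` would make the star condition vacuous for non-discrete `S`, TRIAGE-r1-2). -/
def localSites (a : ℝ) (S : Set E3) : Set E3 := S ∩ closedBall (0 : E3) (2 * a)

/-- `(0, p, q, r)` is a **root cell** of the site set `ω`: `p, q, r` are sites, `0, p, q, r` are affinely
independent, and some sphere through the four points bounds an open ball free of sites (the empty-sphere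
condition of Delaunay, tree `HasEmptyCircumsphere`; sites ON the sphere are allowed, so every
non-degenerate 4-subset through the root of a cospherical Delaunay polytope is a root cell). -/
def IsRootCell (ω : Set E3) (p q r : E3) : Prop :=
  p ∈ ω ∧ q ∈ ω ∧ r ∈ ω ∧ AffineIndependent ℝ ![(0 : E3), p, q, r] ∧
    HasEmptyCircumsphere ω ({(0 : E3), p, q, r} : Set E3)

/-- The root of `S` has an **alphabet star** at scale `a`, tolerance `η`: the root is a site, the local
site set is finite and has the root in the interior of its convex hull (so its Delaunay star covers all
directions), the points of `S` within `3a/2` of the root are pairwise `(1 − η)a` apart, and EVERY root cell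
of the local site set is a letter. -/
def AlphabetStarAt (η a : ℝ) (S : Set E3) : Prop :=
  (0 : E3) ∈ S ∧ (localSites a S).Finite ∧
    (0 : E3) ∈ interior (convexHull ℝ (localSites a S)) ∧
    (∀ x ∈ S, ∀ y ∈ S, x ≠ y → ‖x‖ ≤ 3 / 2 * a → ‖y‖ ≤ 3 / 2 * a → (1 - η) * a ≤ dist x y) ∧
    ∀ p q r : E3, IsRootCell (localSites a S) p q r → IsLetter η a (rootTetEdges p q r)

/-! ### D. Charts onto the two patterns (the interface between the two geometric stubs) -/

/-- A **square** of the unit pattern `P` (cuboctahedron or anticuboctahedron): four pattern points in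
cyclic order with sides `1` and a diagonal `√2`. -/
def IsPatternSquare (P : Finset E3) (u₁ u₂ u₃ u₄ : E3) : Prop :=
  u₁ ∈ P ∧ u₂ ∈ P ∧ u₃ ∈ P ∧ u₄ ∈ P ∧ dist u₁ u₂ = 1 ∧ dist u₂ u₃ = 1 ∧ dist u₃ u₄ = 1 ∧
    dist u₄ u₁ = 1 ∧ dist u₁ u₃ = Real.sqrt 2

/-- **Star chart**: a bijection `σ` from the unit pattern `P` onto the shell `T` under which every pattern
point goes to a point at distance `a ± η·a` from the root, every pattern contact to a pair at distance
`a ± η·a`, and every pattern SQUARE carries octahedral data — a pinned diagonal (`√2·a ± η·a`) or a cap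
point `c` at distance `√2·a ± η·a` from the root and `a ± η·a` from the four corners.  (Exactly what the
letters of an alphabet star supply; the square data remove the jitterbug flex of the bare twelve-shell.) -/
def StarChart (η a : ℝ) (P T : Finset E3) : Prop :=
  ∃ σ : E3 → E3, Set.BijOn σ (↑P : Set E3) (↑T : Set E3) ∧
    (∀ u ∈ P, |‖σ u‖ - a| ≤ η * a) ∧
    (∀ u ∈ P, ∀ v ∈ P, dist u v = 1 → |dist (σ u) (σ v) - a| ≤ η * a) ∧
    ∀ u₁ u₂ u₃ u₄ : E3, IsPatternSquare P u₁ u₂ u₃ u₄ →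
      |dist (σ u₁) (σ u₃) - Real.sqrt 2 * a| ≤ η * a ∨
      |dist (σ u₂) (σ u₄) - Real.sqrt 2 * a| ≤ η * a ∨
      ∃ c : E3, |‖c‖ - Real.sqrt 2 * a| ≤ η * a ∧ |dist c (σ u₁) - a| ≤ η * a ∧
        |dist c (σ u₂) - a| ≤ η * a ∧ |dist c (σ u₃) - a| ≤ η * a ∧ |dist c (σ u₄) - a| ≤ η * a

/-! ### E. The three stub statements -/

/-- **Geometry I — star recognition** (stub `stub_starChart`): an alphabet star at tolerance `η` forces
the root shell (points of `S` other than the root within `5a/4`) to be a finite set charted, at the same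
tolerance, onto the FCC or the HCP pattern with square data.  Mechanism: a Delaunay triangulation of the
local sites exists (tree `exists_isDelaunayTriangulation`) and its cells at the root cover a neighbourhood
of the root (`IsTriangulation.biUnion_cells_mem_nhds_vertex`); they are root cells, hence letters; around
each root edge the letters' dihedral angles sum to `2π`, which below the frustration gap leaves only
"two T + octahedral material `2·arccos(−1/3)`" at a unit edge and "four quarters / two quarters + Z" at a
`√2` edge (`five_mul_lt_two_pi`, `frustrationGap_bounds`, `nat_mul_tetDihedralAngle_ne`); Euler on the
link gives `V = 12`, `8` triangles, `6` squares, two of each at every vertex; the simple such sphere maps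
are the cuboctahedron and the anticuboctahedron (medial-map enumeration, TRIAGE-r1-2), non-simple ones are
excluded metrically by the `(1 − η)a` separation; a 13th point within `5a/4` would be within `0.9a` of a
shell point. -/
def StarRecognition (η : ℝ) : Prop :=
  ∀ a : ℝ, 0 < a → ∀ S : Set E3, AlphabetStarAt η a S →
    ∃ T : Finset E3, (↑T : Set E3) = rootShell a S ∧
      (StarChart η a fccKissingPattern T ∨ StarChart η a hcpKissingPattern T)

/-- **Geometry II — chart rigidity** (stub `stub_chartRigidity`): a `(1 − η)a`-separated finite set
charted at tolerance `η` onto the FCC (resp. HCP) pattern with square data is `(ε·a)`-close, after a linear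
isometry, to the `a`-scaled pattern (`ShellCloseTo`).  Mechanism: every triangle of the chart spans with
the root a near-regular tetrahedron and every square with its datum a first-order-rigid piece (two right
isosceles tetrahedra on a pinned diagonal, or a capped octahedron); pieces sharing a root triangle are
locked; breadth-first placement from a base triangle (depth `≤ 2` in both links) with the nearest-isometry
correction, wrong trilateration branches being excluded by the separation (they sit `≤ 0.71a` from a
shell point).  Registered with `(η, ε) = (1/2000, 1/100)`: amplification budget `20`, against an optimal
linear constant `≤ 5.89` (kit j010844). -/
def ChartRigidity (η ε : ℝ) : Prop :=
  ∀ a : ℝ, 0 < a → ∀ T : Finset E3,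
    (∀ x ∈ T, ∀ y ∈ T, x ≠ y → (1 - η) * a ≤ dist x y) →
    ∀ P : Finset E3, (P = fccKissingPattern ∨ P = hcpKissingPattern) →
      StarChart η a P T → ShellCloseTo (ε * a) T (Finset.image (fun v : E3 => a • v) P)

/-- **Alphabet-star rigidity** (Geometry I + II, `alphabetStarRigidity_of`): an alphabet star at tolerance
`η` forces the root shell to be `(ε·a)`-close to the `a`-scaled FCC or HCP kissing pattern — coordination
twelve and the empty annulus up to `5a/4` included. -/
def AlphabetStarRigidity (η ε : ℝ) : Prop :=
  ∀ a : ℝ, 0 < a → ∀ S : Set E3, AlphabetStarAt η a S →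
    ∃ T : Finset E3, (↑T : Set E3) = rootShell a S ∧
      (ShellCloseTo (ε * a) T (Finset.image (fun v : E3 => a • v) fccKissingPattern) ∨
        ShellCloseTo (ε * a) T (Finset.image (fun v : E3 => a • v) hcpKissingPattern))

/-- **Energy core — alphabet selection** (stub `stub_selection`, stated conditionally on item 9229):
every minimising point-stationary rooted `δ`-hard-core probability law is almost surely alphabet-starred
at the root, at some own scale `a ∈ [9/10, 1]` and the fixed tolerance `η`.  This is the crux's frame
(probability law, a.s. `IsRootedHardCore δ`, `IsPointStationaryLaw`, `E_P[rootEnergy] ≤ e*`) with a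
CELL-level conclusion; it is stronger than the crux and honours the disprover's load-bearing findings
(energy, Mecke, normalisation, unit masses all kept; no slack; law-level, not pointwise). -/
def AlphabetSelection (η : ℝ) : Prop :=
  ∀ δ : ℝ, 0 < δ → ∀ P : Measure (Measure E3), IsProbabilityMeasure P →
    (∀ᵐ μ ∂P, IsRootedHardCore δ μ) → IsPointStationaryLaw P →
    ∫ μ, rootEnergy lennardJones μ ∂P ≤ eStar →
    ∀ᵐ μ ∂P, ∃ a : ℝ, 9 / 10 ≤ a ∧ a ≤ 1 ∧ AlphabetStarAt η a {y : E3 | μ {y} ≠ 0}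

end Summit.AtomisticToContinuum.Crystallization.Theorems.MinimiserShellsAlphabet

/-! ## The line: three registered stubs and the composition -/

namespace Summit.AtomisticToContinuum.Crystallization.Cruxes.MinimiserShells.TwoCellAlphabetStar

open Summit.AtomisticToContinuum.Crystallization.Theorems.MinimiserShellsAlphabet
open Summit.AtomisticToContinuum.Crystallization.Theses.PalmUnimodularRigidity
  (MinimiserShells UnimodularEnergyLowerBound)

/-- Euclidean `3`-space. -/
local notation "E3" => EuclideanSpace ℝ (Fin 3)

/-! ### Registered stubs (the only `sorry`s of the line) -/

/-- **stub_starChart** — Geometry I (`StarRecognition` at `η = 1/2000`).  Size L: Delaunay existence and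
vertex stars are in the tree; the Lean cost is the dihedral-angle closure around an edge of a
triangulation, the Euler count on the link and the enumeration of the two sphere maps; pure geometry, no
potential, no measure.  At `η = 1/2000` the total linear dihedral deviation of any ring at a unit root edge
is `≤ 0.71°` against the `7.36°` gap (kit j010844 parts B–C; slivers Z are grouped with their
near-octahedron, `K_O = 6.13`).  Why it might fail: an exotic lettered star whose link is a NON-simple
`3⁸4⁶` sphere map with two triangles and two squares at each vertex, metrically realisable with `(1 − η)a`
separation (none is expected: the candidates have 2-cycles in the medial preimage, i.e. two faces sharing
two non-adjacent vertices, which the letter geometry forbids). -/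
theorem stub_starChart : StarRecognition (1 / 2000) := by
  sorry

/-- **stub_chartRigidity** — Geometry II (`ChartRigidity` at `(η, ε) = (1/2000, 1/100)`).  Size M–L:
an effective perturbation version of Hales 2012 Lemma 10 (tree: exact `fcc_rigid` / `hcp_rigid` in
`KissingRigidity.lean`) WITH square data and WITHOUT the `1.26` gap (separation `(1 − η)a` only).  Why it
might fail: (i) only through the constant for the linear part — the charted framework is infinitesimally
rigid for every square assignment with optimal sup-norm amplification `≤ 5.36` (fcc) / `≤ 5.89` (hcp)
(kit j010844 part A), so the budget `20` is `3.4×` the optimum; a naive trilateration chain that exceeds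
it is repaired by a better chain or an explicit left inverse of the rigidity matrix over `ℚ(√2)`, not by a
reshape; (ii) a folded, non-congruent realisation of the LABELLED framework on the sphere with all twelve
points `(1 − η)a`-separated (exact case: none; to be excluded case by case). -/
theorem stub_chartRigidity : ChartRigidity (1 / 2000) (1 / 100) := by
  sorry

/-- **stub_selection** — the ENERGY CORE (`UnimodularEnergyLowerBound → AlphabetSelection (1/2000)`),
the hardest stub: crux-hard and stronger than the crux (it pins cell shapes, not just the twelve-shell).
Given 9229 (`e_uni ≥ e*`, the route's support item, so minimising laws have `E_P[h] = e*` exactly), show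
that a minimising point-stationary hard-core law almost surely has, at some scale `a ∈ [9/10, 1]`, local
separation `(1 − 1/2000)a` within `3a/2` of the root, the root interior, and every root cell of the local
Delaunay structure a `(1/2000)`-letter (relaxed LJ hcp: letter distortion `≈ 4.7e-5·a`, a factor `10`
inside; fcc: none; relaxed polytypes `≈ 1e-4·a`).  Expected mechanism: a zero-loss first-order pricing
`E_P[h] ≥ e* + c·P(root not alphabet-starred)` (Disproof §5 `LinearPricing` with the cell predicate;
its constant is capped by the tetragonal-strain Palm witness at mismatch `η`, `≈ 4.4e-4·(100η)²·|e*|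
≈ 1e-6·|e*|` for `η = 1/2000`, Negative/PricingCeiling — hopeless for numerical certificates, so the stub
is provable only STRUCTURALLY, e.g. by showing minimisers are exact rotated relaxed Barlow crystals),
obtained from a boundary-free finite pricing of non-letter cells plus the random-grid transport of 9229
(companion idea `cluster-defect-pricing`), or from the six-ring / coordination rows of
`link-euler-six-ring-tax` inside such a zero-loss architecture.  Why it might fail: a minimising
point-stationary law with a positive density of non-letter root cells — a non-close-packed Lennard-Jones
ground state (polytetrahedral / Frank–Kasper / amorphous), which would refute the crux and every
shell-type line alike; no measure-level local energy inequality for pair potentials in `d = 3` is known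
(Blanc–Lewin 2015 §2.3; Flatley–Theil 2015 need a three-body term). -/
theorem stub_selection : UnimodularEnergyLowerBound → AlphabetSelection (1 / 2000) := by
  sorry

/-! ### Proved glue -/

/-- Monotonicity of `ShellCloseTo` in the tolerance (from `EtaMatched.mono`). -/
theorem shellCloseTo_mono {η η' : ℝ} (hη : η ≤ η') {T P : Finset E3} (h : ShellCloseTo η T P) :
    ShellCloseTo η' T P := by
  obtain ⟨A, hA⟩ := h
  exact ⟨A, hA.mono hη⟩

/-- Folded form of the crux: frame = probability law, a.s. rooted `δ`-hard-core, point-stationary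
(Mecke), minimising `E_P[rootEnergy] ≤ e*`; conclusion a.s. `GoodShell`.  Definitional (`Iff.rfl`). -/
theorem minimiserShells_iff :
    MinimiserShells ↔
      ∀ δ : ℝ, 0 < δ → ∀ P : Measure (Measure E3), IsProbabilityMeasure P →
        (∀ᵐ μ ∂P, IsRootedHardCore δ μ) → IsPointStationaryLaw P →
        ∫ μ, rootEnergy lennardJones μ ∂P ≤ eStar → ∀ᵐ μ ∂P, GoodShell μ :=
  Iff.rfl

/-- **Geometry I + Geometry II ⇒ alphabet-star rigidity** (same tolerance `η`; the separation of the
shell needed by II is part of the alphabet star, shell points having norm `≤ 5a/4 ≤ 3a/2`). -/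
theorem alphabetStarRigidity_of {η ε : ℝ} (hA : StarRecognition η) (hB : ChartRigidity η ε) :
    AlphabetStarRigidity η ε := by
  intro a ha S hstar
  obtain ⟨T, hT, hchart⟩ := hA a ha S hstar
  have hsep : ∀ x ∈ T, ∀ y ∈ T, x ≠ y → (1 - η) * a ≤ dist x y := by
    intro x hx y hy hxy
    have hx' : x ∈ (↑T : Set E3) := Finset.mem_coe.2 hx
    have hy' : y ∈ (↑T : Set E3) := Finset.mem_coe.2 hy
    rw [hT] at hx' hy'
    obtain ⟨hxS, -, hxn⟩ := hx'
    obtain ⟨hyS, -, hyn⟩ := hy'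
    exact hstar.2.2.2.1 x hxS y hyS hxy (by linarith) (by linarith)
  refine ⟨T, hT, ?_⟩
  rcases hchart with hc | hc
  · exact Or.inl (hB a ha T hsep fccKissingPattern (Or.inl rfl) hc)
  · exact Or.inr (hB a ha T hsep hcpKissingPattern (Or.inr rfl) hc)

/-- **Rigidity + selection ⇒ the crux's conclusion almost surely** (unfolded frame; `ε ≤ 1/100` turns
the `ε·a`-closeness into the crux's display tolerance `a/100` by `shellCloseTo_mono`). -/
theorem goodShell_ae_of_alphabet {η ε : ℝ} (hR : AlphabetStarRigidity η ε) (hε : ε ≤ 1 / 100)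
    (hS : AlphabetSelection η) :
    ∀ δ : ℝ, 0 < δ → ∀ P : Measure (Measure E3), IsProbabilityMeasure P →
      (∀ᵐ μ ∂P, IsRootedHardCore δ μ) → IsPointStationaryLaw P →
      ∫ μ, rootEnergy lennardJones μ ∂P ≤ eStar → ∀ᵐ μ ∂P, GoodShell μ := by
  intro δ hδ P hP hcore hstat hmin
  filter_upwards [hS δ hδ P hP hcore hstat hmin] with μ hμ
  obtain ⟨a, ha1, ha2, hstar⟩ := hμ
  have ha : 0 < a := by linarith
  obtain ⟨T, hT, hclose⟩ := hR a ha _ hstar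
  refine ⟨a, ha1, ha2, T, ?_, ?_⟩
  · rw [hT]
    ext y
    exact Iff.rfl
  · have hle : ε * a ≤ a / 100 := by nlinarith
    exact hclose.imp (shellCloseTo_mono hle) (shellCloseTo_mono hle)

/-- **The composition** — `stub_starChart → stub_chartRigidity → stub_selection → MinimiserShells`,
given the route's registered support item 9229 (`UnimodularEnergyLowerBound`, e_uni ≥ e*, which the crux
contains anyway: `Negative/HiddenDependency.lean`).  Concludes the crux decl BY NAME; no `sorry` outside
the three stubs. -/
theorem MinimiserShells_of (hU : UnimodularEnergyLowerBound) : MinimiserShells :=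
  minimiserShells_iff.2
    (goodShell_ae_of_alphabet (alphabetStarRigidity_of stub_starChart stub_chartRigidity)
      (by norm_num) (stub_selection hU))

end Summit.AtomisticToContinuum.Crystallization.Cruxes.MinimiserShells.TwoCellAlphabetStar

end
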